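import Literature.MathematicalPhysics.QuantumFieldTheory.ConformalBootstrap3D.MixedEvenTail
import HarnessLib

/-!
# Rows pairing an `F₋` and an `F₊` point functional (vector-representation sum rules):
# the termwise rule, the limit clause, rule (M) from corner numbers, rule (T) from an apex, the tail

Topic `MathematicalPhysics/QuantumFieldTheory/ConformalBootstrap3D`; definitions + theorems only (no
named fact, no instance, no `sorry`).

In a sum rule whose components are VECTORS over several crossing equations — the `O(N)` vector
bootstrap of Kos–Poland–Simmons-Duffin, JHEP 06 (2014) 091, §2.1 (`V_S = (0, F⁻, F⁺)`,
`V_T = (F⁻, (1-2/N)F⁻, -(1+2/N)F⁺)`, `V_A = (-F⁻, F⁻, -F⁺)` with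
`F^{±}_{Δ,ℓ}(u,v) = v^{Δφ} g_{Δ,ℓ}(u,v) ± u^{Δφ} g_{Δ,ℓ}(v,u)`), or the off-diagonal entry of the
even sector of the mixed `σ–ε` system (`MixedEvenTail`, `Φ⁴₋ + Φ⁵₊`) — a linear functional built
from point evaluations acts on one representation's row as
`g ↦ φ_{a⁻}[F^{s}_{-}[g]] + φ_{a⁺}[F^{s}_{+}[g]]`
with two INDEPENDENT weight vectors `a⁻`, `a⁺` on common nodes `(z_k, z̄_k)` of the open square
(`pointFunctional`, `crossF s (∓1)`). The single-correlator files decide `φ_w[F^{s}_{-}[g]] ≥ 0`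
(`BlockPositive`); this file is the same elementary pipeline for the TWO-SIGN ROW
(`TwoSignPositive a⁻ a⁺ z z̄ s Δ ℓ`: `≥ 0` on every genuine block `g^{0,0}_{Δ,ℓ}`), assembled from
ingredients already in the tree, all of which are stated for an arbitrary sign:

* the termwise action on the Hogervorst–Rychkov `z`-series (`hasSum_twoSign_hrZ`, from
  `hasSum_pointFunctional_crossF_hrZ` at signs `-1` and `+1`) and the resulting rules
  `twoSignPositive_of_termwise` (finite head + non-negative tail terms) / `twoSignPositive_of_forall`
  at regular points [cite: HogervorstRychkov2013, §3 eqs. (3.6), (3.9)];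
* the limit clause at non-regular points (`twoSignPositive_of_eventually_right`, from
  `tendsto_pointFunctional_crossF`);
* the row term `twoSignTerm a⁻ a⁺ z z̄ s E j = φ_{a⁻}[F^{s}_{-}[𝒫_{E,j}]] + φ_{a⁺}[F^{s}_{+}[𝒫_{E,j}]]`
  is the two-weight evaluation `twoWeightEval (a⁻+a⁺) (a⁻-a⁺)` (`sum45_eq_twoWeightEval`), so rule
  (M) on a box `E ∈ [E₁,E₂]`, `s ∈ [s_lo,s_hi]` is ONE corner number `cornerBound₂ ≥ 0`
  (`twoSignTerm_nonneg_of_cornerBound₂`), and a finite table of boxes gives (M) on the twist-gap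
  domain `E ∈ [E₀, E_T)`, `j + τ ≤ E` (`ruleM_twoSign_of_boxTable`);
* rule (T): the SHARP apex estimate for a two-weight evaluation
  (`twoWeightEval_zMono_lower_apex`: `Σ_k (c_k v_k^s 𝒫(z_k) - d_k u_k^s 𝒫(1-z_k)) ≥
  𝒫_{E,j}(apex)·(c_a v_a^s - R₂)`, `R₂ = apexRest₂ c d = Σ_{k≠a}|c_k| v_k^s qd_k^E + Σ_k |d_k| u_k^s qr_k^E`,
  the Legendre growth comparison `zMono_le_of_dominated` of `PointFunctionalTail`; `apexRest₂ w w`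
  is `apexRest w`), whence ONE inequality `R₂(s_lo, E_T) ≤ c_a v_a^{s_hi}` gives every term with
  `E ≥ E_T`, `j ≤ E`, `s ∈ [s_lo, s_hi]` (`twoWeightEval_zMono_nonneg_of_apex`);
* the tail of a two-sign row on a box, all spins, regular or not
  (`tail_twoSignPositive_of_rules_regular`, `tail_twoSignPositive_of_boxes_and_apex`,
  `tail_twoSignPositive_of_table_and_apex`).

Dictionary to the `O(N)` certificate format (`ONVectorCertificate`: `RowNonnegS/T/A`,
`diamondFunctional`, `rowNonnegS_of_crossF`, `diamondFunctional_VS_eq` …): the `S`-row of the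
diamond functional with weights `w : Fin n → Fin 3 → ℝ` is the two-sign row with
`(a⁻, a⁺) = (wSm w, wSp w) = (w · 1, w · 2)`, the `T`-row has `(wTm N w, wTp N w)`, the `A`-row
`(wAm w, wAp w)`; so `TwoSignPositive` at `(s, Δ, ℓ) = (Δφ, Δ, ℓ)` for those weight pairs is exactly
what `rowNonnegS/T/A_of_crossF` consume, and the tail obligations `(O7)–(O9)` of
`VectorObligations` are three instances of `tail_twoSignPositive_of_table_and_apex`. (That file is
not imported here: everything below is stated over the single-correlator primitives.) With `a⁺ = 0`
the row is the single-correlator one (`twoSignPositive_zero_right_iff`).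

No block is evaluated here; these are inequalities between the terms of the proved expansion, and
the numbers a certificate must supply are the corner numbers `cornerBound₂` of finitely many boxes,
finitely many head terms, and one apex inequality per row.
-/

noncomputable section

namespace Literature.MathematicalPhysics.QuantumFieldTheory.ConformalBootstrap3D

open Finset Set Filter Topology

/-! ### The two-sign row and its terms -/

/-- **Positivity of a two-sign row at `(Δ, ℓ)`** for external exponent `s`:
`φ_{a⁻}[F^{s}_{-}[g]] + φ_{a⁺}[F^{s}_{+}[g]] ≥ 0` for every genuine block `g = g^{0,0}_{Δ,ℓ}`
(`IsConformalBlock3D 0 0 Δ ℓ`), where `φ_{a}` is the point functional with weights `a` on the nodes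
`(z_k, z̄_k)`. The row shape of the `O(N)` vector sum rule.
[cite: KosPolandSimmonsduffin2014ON, §2.1 (vector sum rule)] -/
def TwoSignPositive {n : ℕ} (am ap z zb : Fin n → ℝ) (s Δ : ℝ) (ℓ : ℕ) : Prop :=
  ∀ g : ℝ → ℝ → ℝ, IsConformalBlock3D 0 0 Δ ℓ g →
    0 ≤ pointFunctional am z zb (crossF s (-1) g) + pointFunctional ap z zb (crossF s 1 g)

/-- **The row term**: the value of the two-sign row on the `z`-series monomial `𝒫_{E,j} = zMono E j`,
`twoSignTerm a⁻ a⁺ z z̄ s E j = φ_{a⁻}[F^{s}_{-}[𝒫_{E,j}]] + φ_{a⁺}[F^{s}_{+}[𝒫_{E,j}]]`.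
[cite: HogervorstRychkov2013, §3 eq. (3.6)] -/
def twoSignTerm {n : ℕ} (am ap z zb : Fin n → ℝ) (s E : ℝ) (j : ℕ) : ℝ :=
  pointFunctional am z zb (crossF s (-1) (zMono E j)) + pointFunctional ap z zb (crossF s 1 (zMono E j))

/-- The row term is the two-weight evaluation with `(c, d) = (a⁻ + a⁺, a⁻ - a⁺)`:
`Σ_k ((a⁻_k + a⁺_k) v_k^s 𝒫(z_k,z̄_k) - (a⁻_k - a⁺_k) u_k^s 𝒫(1-z_k,1-z̄_k))` — the `(F⁻, F⁺)`
pairing of the vector sum rule written out on point evaluations.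
[cite: KosPolandSimmonsduffin2014ON, §2.1] -/
theorem twoSignTerm_eq_twoWeightEval {n : ℕ} (am ap z zb : Fin n → ℝ) (s E : ℝ) (j : ℕ) :
    twoSignTerm am ap z zb s E j = twoWeightEval (am + ap) (am - ap) z zb s (zMono E j) :=
  sum45_eq_twoWeightEval am ap z zb s (zMono E j)

/-- The point functional with zero weights vanishes (plumbing for the dictionary below). [folklore] -/
private theorem pointFunctional_zero_weights {n : ℕ} (z zb : Fin n → ℝ) (F : ℝ → ℝ → ℝ) :
    pointFunctional (0 : Fin n → ℝ) z zb F = 0 := by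
  simp [pointFunctional_apply]

/-- **Dictionary to the single-correlator row**: with `a⁺ = 0` the two-sign row is
`BlockPositive φ_{a⁻}` — the linear-functional rule of the single-correlator bootstrap.
[cite: RattazziEtAl2008, §5.5] -/
theorem twoSignPositive_zero_right_iff {n : ℕ} (am z zb : Fin n → ℝ) (s Δ : ℝ) (ℓ : ℕ) :
    TwoSignPositive am 0 z zb s Δ ℓ ↔ BlockPositive (pointFunctional am z zb) s Δ ℓ := by
  simp only [TwoSignPositive, BlockPositive, pointFunctional_zero_weights, add_zero]

/-! ### The termwise rule at a regular point -/

/-- **Termwise action of a two-sign row on the `z`-series** (regular `(Δ, ℓ)`, genuine block `g`):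
`φ_{a⁻}[F^{s}_{-}[g]] + φ_{a⁺}[F^{s}_{+}[g]] = Σ_{(n,j)} (A_{n,j}/λ_ℓ) · twoSignTerm(s, Δ+n, j)` — the
sum of the termwise actions at signs `-1` and `+1`. [cite: HogervorstRychkov2013, §3 eqs. (3.4), (3.9)] -/
theorem hasSum_twoSign_hrZ {n : ℕ} (am ap z zb : Fin n → ℝ)
    (hz : ∀ k, z k ∈ Ioo (0 : ℝ) 1) (hzb : ∀ k, zb k ∈ Ioo (0 : ℝ) 1) (s : ℝ) {Δ : ℝ} {ℓ : ℕ}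
    {g : ℝ → ℝ → ℝ} (hΔ : unitarityBound3D ℓ < Δ) (hreg : ¬ accidentalDegeneracy3D Δ ℓ)
    (h : IsConformalBlock3D 0 0 Δ ℓ g) :
    HasSum (fun q : ℕ × ℕ => hrCoeff Δ ℓ q.1 q.2 / legendreLam ℓ *
        twoSignTerm am ap z zb s (Δ + (q.1 : ℝ)) q.2)
      (pointFunctional am z zb (crossF s (-1) g) + pointFunctional ap z zb (crossF s 1 g)) := by
  have h1 := hasSum_pointFunctional_crossF_hrZ am z zb hz hzb s (-1) hΔ hreg h
  have h2 := hasSum_pointFunctional_crossF_hrZ ap z zb hz hzb s 1 hΔ hreg h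
  exact (h1.add h2).congr_fun fun q => by simp only [twoSignTerm]; ring

/-- **Two-sign positivity from termwise positivity (finite head + non-negative tail terms).** At a
regular `(Δ, ℓ)`: if the head `Σ_{(n,j) ∈ F} (A_{n,j}/λ_ℓ) twoSignTerm(s, Δ+n, j) ≥ 0` and every term
outside `F` on the descendant range is `≥ 0`, the two-sign row is non-negative at `(Δ, ℓ)` (the
coefficients `A_{n,j}/λ_ℓ` are `≥ 0` above the unitarity bound).
[cite: HogervorstRychkov2013, §3 eq. (3.9)] -/
theorem twoSignPositive_of_termwise {n : ℕ} (am ap z zb : Fin n → ℝ)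
    (hz : ∀ k, z k ∈ Ioo (0 : ℝ) 1) (hzb : ∀ k, zb k ∈ Ioo (0 : ℝ) 1) {s Δ : ℝ} {ℓ : ℕ}
    (hΔ : unitarityBound3D ℓ < Δ) (hreg : ¬ accidentalDegeneracy3D Δ ℓ) (F : Finset (ℕ × ℕ))
    (hhead : 0 ≤ ∑ q ∈ F, hrCoeff Δ ℓ q.1 q.2 / legendreLam ℓ *
      twoSignTerm am ap z zb s (Δ + (q.1 : ℝ)) q.2)
    (htail : ∀ q : ℕ × ℕ, q ∉ F → InDescendantRange ℓ q.1 q.2 →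
      0 ≤ twoSignTerm am ap z zb s (Δ + (q.1 : ℝ)) q.2) :
    TwoSignPositive am ap z zb s Δ ℓ := by
  intro g hg
  have hS := hasSum_twoSign_hrZ am ap z zb hz hzb s hΔ hreg hg
  refine hhead.trans (sum_le_hasSum F (fun q hq => ?_) hS)
  by_cases hr : InDescendantRange ℓ q.1 q.2
  · exact mul_nonneg (div_nonneg (hrCoeff_nonneg hΔ _ _) (legendreLam_pos ℓ).le) (htail q hq hr)
  · rw [hrCoeff_eq_zero_of_not_inDescendantRange Δ hr, zero_div, zero_mul]

/-- **Fully termwise form** (`F = ∅`). [cite: HogervorstRychkov2013, §3 eq. (3.9)] -/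
theorem twoSignPositive_of_forall {n : ℕ} (am ap z zb : Fin n → ℝ)
    (hz : ∀ k, z k ∈ Ioo (0 : ℝ) 1) (hzb : ∀ k, zb k ∈ Ioo (0 : ℝ) 1) {s Δ : ℝ} {ℓ : ℕ}
    (hΔ : unitarityBound3D ℓ < Δ) (hreg : ¬ accidentalDegeneracy3D Δ ℓ)
    (hterm : ∀ q : ℕ × ℕ, InDescendantRange ℓ q.1 q.2 →
      0 ≤ twoSignTerm am ap z zb s (Δ + (q.1 : ℝ)) q.2) :
    TwoSignPositive am ap z zb s Δ ℓ :=
  twoSignPositive_of_termwise am ap z zb hz hzb hΔ hreg ∅ (by simp) (fun q _ hr => hterm q hr)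

/-! ### The limit clause: non-regular points from the right -/

/-- **Two-sign positivity at a non-regular point from the right.** If `(Δ, ℓ)` is not regular and the
row is non-negative at the (regular) points of a right neighbourhood of `Δ`, it is non-negative at
`(Δ, ℓ)`: the row is a finite combination of point values, continuous along the limit clause of
`IsConformalBlock3D` (`tendsto_pointFunctional_crossF` at both signs, `ge_of_tendsto`); the blocks
are continuous in `Δ` from the right at the unitarity bound and at the accidental degeneracies of the
`z`-series recursion. [cite: PolandRychkovVichi2019, §II.C eq. (19)] -/
theorem twoSignPositive_of_eventually_right {n : ℕ} (am ap z zb : Fin n → ℝ)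
    (hz : ∀ k, z k ∈ Ioo (0 : ℝ) 1) (hzb : ∀ k, zb k ∈ Ioo (0 : ℝ) 1) (s Δ : ℝ) (ℓ : ℕ)
    (hΔ : ¬ IsRegularPoint3D Δ ℓ)
    (h : ∀ᶠ Δ' in 𝓝[>] Δ, IsRegularPoint3D Δ' ℓ ∧ TwoSignPositive am ap z zb s Δ' ℓ) :
    TwoSignPositive am ap z zb s Δ ℓ := by
  intro g hg
  rcases hg with ⟨hreg, _⟩ | ⟨_, G, hGabove, hGlim⟩
  · exact absurd hreg hΔ
  have hlim := (tendsto_pointFunctional_crossF am z zb hz hzb s (-1) G g (𝓝[>] Δ) hGlim).add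
    (tendsto_pointFunctional_crossF ap z zb hz hzb s 1 G g (𝓝[>] Δ) hGlim)
  refine ge_of_tendsto hlim ?_
  have hIoo : Ioo Δ (Δ + 1) ∈ 𝓝[>] Δ := Ioo_mem_nhdsGT (by linarith)
  filter_upwards [h, hIoo] with Δ' hΔ' hmem
  exact hΔ'.2 (G Δ') (Or.inl ⟨hΔ'.1, hGabove Δ' hmem⟩)

/-! ### Rule (M): one corner number per box, a finite table per row -/

/-- **(M) for a two-sign row:** one inequality `0 ≤ cornerBound₂ (a⁻+a⁺) (a⁻-a⁺) z z̄ j E₁ E₂ s_lo s_hi`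
gives `twoSignTerm(s, E, j) ≥ 0` on the whole box `E ∈ [E₁, E₂]`, `s ∈ [s_lo, s_hi]` (term basis
`𝒫_{E,j} = s^E P_j(ξ)`, monotone in `E` on the open square). [cite: HogervorstRychkov2013, §3 eq. (3.6)] -/
theorem twoSignTerm_nonneg_of_cornerBound₂ {n : ℕ} (am ap z zb : Fin n → ℝ)
    (hz : ∀ k, z k ∈ Ioo (0 : ℝ) 1) (hzb : ∀ k, zb k ∈ Ioo (0 : ℝ) 1) (j : ℕ)
    {E₁ E₂ slo shi : ℝ} (h : 0 ≤ cornerBound₂ (am + ap) (am - ap) z zb j E₁ E₂ slo shi) :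
    ∀ E ∈ Icc E₁ E₂, ∀ s ∈ Icc slo shi, 0 ≤ twoSignTerm am ap z zb s E j := by
  intro E hE s hs
  rw [twoSignTerm_eq_twoWeightEval]
  exact h.trans (cornerBound₂_le (am + ap) (am - ap) z zb hz hzb j hE hs)

/-- **(M) on the twist-gap domain from a table of boxes.** For every `j` with `j + τ < E_T` a row of
box endpoints `e_{j,0} ≤ e_{j,1} ≤ … ≤ e_{j,M_j}` with `e_{j,0} ≤ max(E₀, j + τ)`, `E_T ≤ e_{j,M_j}`
and one corner number `≥ 0` per box give `twoSignTerm(s, E, j) ≥ 0` for all `E ∈ [E₀, E_T)`,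
`j + τ ≤ E`, `s ∈ [s_lo, s_hi]`. (Only finitely many `j` have `j + τ < E_T`.)
[cite: HogervorstRychkov2013, §3 eq. (3.6)] -/
theorem ruleM_twoSign_of_boxTable {n : ℕ} (am ap z zb : Fin n → ℝ)
    (hz : ∀ k, z k ∈ Ioo (0 : ℝ) 1) (hzb : ∀ k, zb k ∈ Ioo (0 : ℝ) 1)
    {slo shi E₀ ET : ℝ} (τ : ℝ) (e : ℕ → ℕ → ℝ) (M : ℕ → ℕ)
    (he : ∀ j : ℕ, (j : ℝ) + τ < ET → e j 0 ≤ max E₀ ((j : ℝ) + τ) ∧ ET ≤ e j (M j))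
    (hbox : ∀ j : ℕ, (j : ℝ) + τ < ET → ∀ m < M j,
      0 ≤ cornerBound₂ (am + ap) (am - ap) z zb j (e j m) (e j (m + 1)) slo shi) :
    ∀ (j : ℕ) (E : ℝ), E₀ ≤ E → E < ET → (j : ℝ) + τ ≤ E → ∀ s ∈ Icc slo shi,
      0 ≤ twoSignTerm am ap z zb s E j := by
  intro j E hE0 hET hjE s hs
  have hjT : (j : ℝ) + τ < ET := lt_of_le_of_lt hjE hET
  obtain ⟨he0, heM⟩ := he j hjT
  have hE : E ∈ Ico (e j 0) (e j (M j)) := ⟨he0.trans (max_le hE0 hjE), lt_of_lt_of_le hET heM⟩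
  obtain ⟨m, hm, hEm⟩ := exists_cell_Ico (e j) (M j) E hE
  exact twoSignTerm_nonneg_of_cornerBound₂ am ap z zb hz hzb j (hbox j hjT m hm) E
    ⟨hEm.1, hEm.2.le⟩ s hs

/-! ### Rule (T): the sharp apex estimate for a two-weight evaluation -/

/-- The two-weight apex remainder
`R₂(c, d; t, T) = Σ_{k≠a} |c_k| v_k^t qd_k^T + Σ_k |d_k| u_k^t qr_k^T`
(`v = (1-z)(1-z̄)`, `u = z z̄`); `apexRest` is the case `c = d`. [cite: HogervorstRychkov2013, §3 eq. (3.6)] -/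
def apexRest₂ {n : ℕ} (c d z zb : Fin n → ℝ) (a : Fin n) (qd qr : Fin n → ℝ) (t T : ℝ) : ℝ :=
  ∑ k ∈ univ.erase a, |c k| * ((1 - z k) * (1 - zb k)) ^ t * qd k ^ T
    + ∑ k, |d k| * (z k * zb k) ^ t * qr k ^ T

/-- `R₂(w, w) = R(w)`. [cite: HogervorstRychkov2013, §3 eq. (3.6)] -/
theorem apexRest₂_self {n : ℕ} (w z zb : Fin n → ℝ) (a : Fin n) (qd qr : Fin n → ℝ) (t T : ℝ) :
    apexRest₂ w w z zb a qd qr t T = apexRest w z zb a qd qr t T := rfl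

/-- `R₂ ≥ 0`. [cite: HogervorstRychkov2013, §3 eq. (3.6)] -/
theorem apexRest₂_nonneg {n : ℕ} (c d z zb : Fin n → ℝ) (hz : ∀ k, z k ∈ Ioo (0 : ℝ) 1)
    (hzb : ∀ k, zb k ∈ Ioo (0 : ℝ) 1) (a : Fin n) (qd qr : Fin n → ℝ) (hqd : ∀ k, 0 ≤ qd k)
    (hqr : ∀ k, 0 ≤ qr k) (t T : ℝ) : 0 ≤ apexRest₂ c d z zb a qd qr t T := by
  unfold apexRest₂
  refine add_nonneg (sum_nonneg fun k _ => ?_) (sum_nonneg fun k _ => ?_)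
  · exact mul_nonneg (mul_nonneg (abs_nonneg _) (Real.rpow_nonneg
      (mul_nonneg (by linarith [(hz k).2]) (by linarith [(hzb k).2])) _)) (Real.rpow_nonneg (hqd k) _)
  · exact mul_nonneg (mul_nonneg (abs_nonneg _) (Real.rpow_nonneg
      (mul_nonneg (hz k).1.le (hzb k).1.le) _)) (Real.rpow_nonneg (hqr k) _)

/-- `R₂` is non-increasing in the exponent `t` (`u_k, v_k ∈ (0, 1]`). [cite: HogervorstRychkov2013, §3 eq. (3.6)] -/
theorem apexRest₂_anti_exponent {n : ℕ} (c d z zb : Fin n → ℝ) (hz : ∀ k, z k ∈ Ioo (0 : ℝ) 1)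
    (hzb : ∀ k, zb k ∈ Ioo (0 : ℝ) 1) (a : Fin n) (qd qr : Fin n → ℝ) (hqd : ∀ k, 0 ≤ qd k)
    (hqr : ∀ k, 0 ≤ qr k) {t t' : ℝ} (h : t ≤ t') (T : ℝ) :
    apexRest₂ c d z zb a qd qr t' T ≤ apexRest₂ c d z zb a qd qr t T := by
  have hv : ∀ k, 0 < (1 - z k) * (1 - zb k) ∧ (1 - z k) * (1 - zb k) ≤ 1 := fun k =>
    ⟨mul_pos (by linarith [(hz k).2]) (by linarith [(hzb k).2]),
      mul_le_one₀ (by linarith [(hz k).1]) (by linarith [(hzb k).2]) (by linarith [(hzb k).1])⟩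
  have hu : ∀ k, 0 < z k * zb k ∧ z k * zb k ≤ 1 := fun k =>
    ⟨mul_pos (hz k).1 (hzb k).1, mul_le_one₀ (hz k).2.le (hzb k).1.le (hzb k).2.le⟩
  unfold apexRest₂
  refine add_le_add (sum_le_sum fun k _ => ?_) (sum_le_sum fun k _ => ?_)
  · exact mul_le_mul_of_nonneg_right (mul_le_mul_of_nonneg_left
      (Real.rpow_le_rpow_of_exponent_ge (hv k).1 (hv k).2 h) (abs_nonneg _))
      (Real.rpow_nonneg (hqd k) _)
  · exact mul_le_mul_of_nonneg_right (mul_le_mul_of_nonneg_left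
      (Real.rpow_le_rpow_of_exponent_ge (hu k).1 (hu k).2 h) (abs_nonneg _))
      (Real.rpow_nonneg (hqr k) _)

/-- `R₂` is non-increasing in the level `T` (ratios `qd_k, qr_k ∈ (0, 1]`). [cite: HogervorstRychkov2013, §3 eq. (3.6)] -/
theorem apexRest₂_anti_level {n : ℕ} (c d z zb : Fin n → ℝ) (hz : ∀ k, z k ∈ Ioo (0 : ℝ) 1)
    (hzb : ∀ k, zb k ∈ Ioo (0 : ℝ) 1) (a : Fin n) (qd qr : Fin n → ℝ)
    (hqd : ∀ k, 0 < qd k ∧ qd k ≤ 1) (hqr : ∀ k, 0 < qr k ∧ qr k ≤ 1) (t : ℝ) {T T' : ℝ}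
    (h : T ≤ T') : apexRest₂ c d z zb a qd qr t T' ≤ apexRest₂ c d z zb a qd qr t T := by
  have hv0 : ∀ k, 0 ≤ (1 - z k) * (1 - zb k) := fun k =>
    mul_nonneg (by linarith [(hz k).2]) (by linarith [(hzb k).2])
  have hu0 : ∀ k, 0 ≤ z k * zb k := fun k => mul_nonneg (hz k).1.le (hzb k).1.le
  unfold apexRest₂
  refine add_le_add (sum_le_sum fun k _ => ?_) (sum_le_sum fun k _ => ?_)
  · exact mul_le_mul_of_nonneg_left (Real.rpow_le_rpow_of_exponent_ge (hqd k).1 (hqd k).2 h)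
      (mul_nonneg (abs_nonneg _) (Real.rpow_nonneg (hv0 k) _))
  · exact mul_le_mul_of_nonneg_left (Real.rpow_le_rpow_of_exponent_ge (hqr k).1 (hqr k).2 h)
      (mul_nonneg (abs_nonneg _) (Real.rpow_nonneg (hu0 k) _))

/-- **Sharp apex lower bound for a two-weight evaluation.** Nodes in the open square with
`z̄_k ≤ z_k`; an apex node `a`; ratios `qd_k, qr_k > 0` with `z_k z̄_k ≤ qd_k² z_a z̄_a`,
`z_k ≤ qd_k z_a` (direct nodes) and `(1-z_k)(1-z̄_k) ≤ qr_k² z_a z̄_a`, `1-z̄_k ≤ qr_k z_a`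
(reflected nodes). Then for `j ≤ E`,
`Σ_k (c_k v_k^s 𝒫_{E,j}(z_k,z̄_k) - d_k u_k^s 𝒫_{E,j}(1-z_k,1-z̄_k)) ≥ 𝒫_{E,j}(z_a,z̄_a)·(c_a v_a^s - R₂(c,d; s, E))`
— the Legendre growth comparison `zMono_le_of_dominated` termwise, with the direct weights `c` and
the reflected weights `d` estimated separately (`pointFunctional_crossF_zMono_lower` is `c = d`); in
the variables `(s, ρ)` of the term basis `𝒫_{E,j} = s^E P_j(cosh log ρ)` this is
`P_j(ξ) ≤ max(1, ρ/ρ')^j P_j(ξ')`, `s^E ≤ (s/s')^E s'^E`. [cite: HogervorstRychkov2013, §3 eq. (3.6)] -/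
theorem twoWeightEval_zMono_lower_apex {N : ℕ} (c d z zb : Fin N → ℝ)
    (hz : ∀ k, z k ∈ Ioo (0 : ℝ) 1) (hzb : ∀ k, zb k ∈ Ioo (0 : ℝ) 1) (hord : ∀ k, zb k ≤ z k)
    (a : Fin N) (qd qr : Fin N → ℝ) (hqd : ∀ k, 0 < qd k) (hqr : ∀ k, 0 < qr k)
    (hdomd : ∀ k, z k * zb k ≤ qd k ^ 2 * (z a * zb a) ∧ z k ≤ qd k * z a)
    (hdomr : ∀ k, (1 - z k) * (1 - zb k) ≤ qr k ^ 2 * (z a * zb a) ∧ 1 - zb k ≤ qr k * z a)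
    {E : ℝ} {j : ℕ} (hjE : (j : ℝ) ≤ E) (s : ℝ) :
    zMono E j (z a) (zb a) *
        (c a * ((1 - z a) * (1 - zb a)) ^ s - apexRest₂ c d z zb a qd qr s E) ≤
      twoWeightEval c d z zb s (zMono E j) := by
  have hv0 : ∀ k, 0 ≤ (1 - z k) * (1 - zb k) := fun k =>
    mul_nonneg (by linarith [(hz k).2]) (by linarith [(hzb k).2])
  have hu0 : ∀ k, 0 ≤ z k * zb k := fun k => mul_nonneg (hz k).1.le (hzb k).1.le
  -- direct nodes are dominated by the apex
  have hMk : ∀ k, zMono E j (z k) (zb k) ≤ qd k ^ E * zMono E j (z a) (zb a) := fun k =>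
    zMono_le_of_dominated (hzb k).1 (hord k) (hzb a).1 (hord a) (hqd k) (hdomd k).1 (hdomd k).2 hjE
  -- reflected nodes are dominated by the apex
  have hRk : ∀ k, zMono E j (1 - z k) (1 - zb k) ≤ qr k ^ E * zMono E j (z a) (zb a) := by
    intro k
    rw [← zMono_symm]
    have h1 : (1 - zb k) * (1 - z k) ≤ qr k ^ 2 * (z a * zb a) := by
      rw [mul_comm]; exact (hdomr k).1
    exact zMono_le_of_dominated (by linarith [(hz k).2]) (by linarith [hord k]) (hzb a).1 (hord a)
      (hqr k) h1 (hdomr k).2 hjE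
  -- termwise lower bounds: direct weights `c`
  have hterm1 : ∀ k, -(|c k| * ((1 - z k) * (1 - zb k)) ^ s * qd k ^ E * zMono E j (z a) (zb a)) ≤
      c k * ((1 - z k) * (1 - zb k)) ^ s * zMono E j (z k) (zb k) := by
    intro k
    have hvs : 0 ≤ ((1 - z k) * (1 - zb k)) ^ s := Real.rpow_nonneg (hv0 k) s
    have h1 : -|c k| * (((1 - z k) * (1 - zb k)) ^ s * zMono E j (z k) (zb k)) ≤
        c k * (((1 - z k) * (1 - zb k)) ^ s * zMono E j (z k) (zb k)) :=
      mul_le_mul_of_nonneg_right (neg_abs_le _)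
        (mul_nonneg hvs (zMono_nonneg E j (hz k).1.le (hzb k).1.le))
    have h2 : -|c k| * ((1 - z k) * (1 - zb k)) ^ s * (qd k ^ E * zMono E j (z a) (zb a)) ≤
        -|c k| * ((1 - z k) * (1 - zb k)) ^ s * zMono E j (z k) (zb k) :=
      mul_le_mul_of_nonpos_left (hMk k)
        (mul_nonpos_of_nonpos_of_nonneg (neg_nonpos.2 (abs_nonneg _)) hvs)
    calc -(|c k| * ((1 - z k) * (1 - zb k)) ^ s * qd k ^ E * zMono E j (z a) (zb a))
        = -|c k| * ((1 - z k) * (1 - zb k)) ^ s * (qd k ^ E * zMono E j (z a) (zb a)) := by ring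
      _ ≤ -|c k| * ((1 - z k) * (1 - zb k)) ^ s * zMono E j (z k) (zb k) := h2
      _ = -|c k| * (((1 - z k) * (1 - zb k)) ^ s * zMono E j (z k) (zb k)) := by ring
      _ ≤ c k * (((1 - z k) * (1 - zb k)) ^ s * zMono E j (z k) (zb k)) := h1
      _ = c k * ((1 - z k) * (1 - zb k)) ^ s * zMono E j (z k) (zb k) := by ring
  -- termwise lower bounds: reflected weights `d`
  have hterm2 : ∀ k, -(|d k| * (z k * zb k) ^ s * qr k ^ E * zMono E j (z a) (zb a)) ≤
      -(d k * (z k * zb k) ^ s * zMono E j (1 - z k) (1 - zb k)) := by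
    intro k
    have hus : 0 ≤ (z k * zb k) ^ s := Real.rpow_nonneg (hu0 k) s
    apply neg_le_neg
    have h1 : d k * ((z k * zb k) ^ s * zMono E j (1 - z k) (1 - zb k)) ≤
        |d k| * ((z k * zb k) ^ s * zMono E j (1 - z k) (1 - zb k)) :=
      mul_le_mul_of_nonneg_right (le_abs_self _)
        (mul_nonneg hus (zMono_nonneg E j (by linarith [(hz k).2]) (by linarith [(hzb k).2])))
    have h2 : |d k| * (z k * zb k) ^ s * zMono E j (1 - z k) (1 - zb k) ≤
        |d k| * (z k * zb k) ^ s * (qr k ^ E * zMono E j (z a) (zb a)) :=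
      mul_le_mul_of_nonneg_left (hRk k) (mul_nonneg (abs_nonneg _) hus)
    calc d k * (z k * zb k) ^ s * zMono E j (1 - z k) (1 - zb k)
        = d k * ((z k * zb k) ^ s * zMono E j (1 - z k) (1 - zb k)) := by ring
      _ ≤ |d k| * ((z k * zb k) ^ s * zMono E j (1 - z k) (1 - zb k)) := h1
      _ = |d k| * (z k * zb k) ^ s * zMono E j (1 - z k) (1 - zb k) := by ring
      _ ≤ |d k| * (z k * zb k) ^ s * (qr k ^ E * zMono E j (z a) (zb a)) := h2
      _ = |d k| * (z k * zb k) ^ s * qr k ^ E * zMono E j (z a) (zb a) := by ring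
  -- assemble
  calc zMono E j (z a) (zb a) *
        (c a * ((1 - z a) * (1 - zb a)) ^ s - apexRest₂ c d z zb a qd qr s E)
      = c a * ((1 - z a) * (1 - zb a)) ^ s * zMono E j (z a) (zb a)
          + ∑ k ∈ univ.erase a,
              -(|c k| * ((1 - z k) * (1 - zb k)) ^ s * qd k ^ E * zMono E j (z a) (zb a))
          + ∑ k, -(|d k| * (z k * zb k) ^ s * qr k ^ E * zMono E j (z a) (zb a)) := by
        rw [apexRest₂, sum_neg_distrib, sum_neg_distrib, ← sum_mul, ← sum_mul]
        ring
    _ ≤ c a * ((1 - z a) * (1 - zb a)) ^ s * zMono E j (z a) (zb a)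
          + ∑ k ∈ univ.erase a, c k * ((1 - z k) * (1 - zb k)) ^ s * zMono E j (z k) (zb k)
          + ∑ k, -(d k * (z k * zb k) ^ s * zMono E j (1 - z k) (1 - zb k)) :=
        add_le_add (add_le_add le_rfl (sum_le_sum fun k _ => hterm1 k))
          (sum_le_sum fun k _ => hterm2 k)
    _ = ∑ k, c k * ((1 - z k) * (1 - zb k)) ^ s * zMono E j (z k) (zb k)
          + ∑ k, -(d k * (z k * zb k) ^ s * zMono E j (1 - z k) (1 - zb k)) := by
        rw [add_sum_erase univ (fun k => c k * ((1 - z k) * (1 - zb k)) ^ s * zMono E j (z k) (zb k))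
          (mem_univ a)]
    _ = twoWeightEval c d z zb s (zMono E j) := by
        rw [twoWeightEval, ← sum_add_distrib]
        refine sum_congr rfl fun k _ => ?_
        ring

/-- **(T) for a two-weight evaluation on a box.** With all ratios `≤ 1`, `0 ≤ c_a` and the single
inequality `R₂(c, d; s_lo, E_T) ≤ c_a v_a^{s_hi}`, every term with `E ≥ E_T`, `j ≤ E` and
`s ∈ [s_lo, s_hi]` is `≥ 0` (`v_a^s ≥ v_a^{s_hi}`, `R₂(s, E) ≤ R₂(s_lo, E_T)`).
[cite: HogervorstRychkov2013, §3 eq. (3.6)] -/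
theorem twoWeightEval_zMono_nonneg_of_apex {N : ℕ} (c d z zb : Fin N → ℝ)
    (hz : ∀ k, z k ∈ Ioo (0 : ℝ) 1) (hzb : ∀ k, zb k ∈ Ioo (0 : ℝ) 1) (hord : ∀ k, zb k ≤ z k)
    (a : Fin N) (ha : 0 ≤ c a) (qd qr : Fin N → ℝ) (hqd : ∀ k, 0 < qd k ∧ qd k ≤ 1)
    (hqr : ∀ k, 0 < qr k ∧ qr k ≤ 1)
    (hdomd : ∀ k, z k * zb k ≤ qd k ^ 2 * (z a * zb a) ∧ z k ≤ qd k * z a)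
    (hdomr : ∀ k, (1 - z k) * (1 - zb k) ≤ qr k ^ 2 * (z a * zb a) ∧ 1 - zb k ≤ qr k * z a)
    {slo shi ET : ℝ}
    (hB : apexRest₂ c d z zb a qd qr slo ET ≤ c a * ((1 - z a) * (1 - zb a)) ^ shi) :
    ∀ E : ℝ, ET ≤ E → ∀ j : ℕ, (j : ℝ) ≤ E → ∀ s ∈ Icc slo shi,
      0 ≤ twoWeightEval c d z zb s (zMono E j) := by
  intro E hE j hj s hs
  have hva : 0 < (1 - z a) * (1 - zb a) ∧ (1 - z a) * (1 - zb a) ≤ 1 :=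
    ⟨mul_pos (by linarith [(hz a).2]) (by linarith [(hzb a).2]),
      mul_le_one₀ (by linarith [(hz a).1]) (by linarith [(hzb a).2]) (by linarith [(hzb a).1])⟩
  have h1 : apexRest₂ c d z zb a qd qr s E ≤ apexRest₂ c d z zb a qd qr slo ET :=
    (apexRest₂_anti_level c d z zb hz hzb a qd qr hqd hqr s hE).trans
      (apexRest₂_anti_exponent c d z zb hz hzb a qd qr (fun k => (hqd k).1.le)
        (fun k => (hqr k).1.le) hs.1 ET)
  have h2 : c a * ((1 - z a) * (1 - zb a)) ^ shi ≤ c a * ((1 - z a) * (1 - zb a)) ^ s :=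
    mul_le_mul_of_nonneg_left (Real.rpow_le_rpow_of_exponent_ge hva.1 hva.2 hs.2) ha
  have hlow := twoWeightEval_zMono_lower_apex c d z zb hz hzb hord a qd qr (fun k => (hqd k).1)
    (fun k => (hqr k).1) hdomd hdomr hj s
  exact le_trans (mul_nonneg (zMono_nonneg _ _ (hz a).1.le (hzb a).1.le) (by linarith)) hlow

/-! ### The tail of a two-sign row -/

/-- **The tail at a regular point, twist-gap domain.** Termwise positivity of `twoSignTerm(s, E, j)`
for `E ∈ [E₀, E_T)`, `j + τ ≤ E` (rule (M), `τ ≤ 1`, `τ ≤ E₀`) and for `E ≥ E_T`, `j ≤ E` (rule (T))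
give `TwoSignPositive` at every regular `(Δ, ℓ)` with `Δ ≥ E₀` above the unitarity bound — for EVERY
spin `ℓ` (the terms `(n, j)` of the block have `j + τ ≤ ℓ + n + τ ≤ Δ + n = E`).
[cite: HogervorstRychkov2013, §3 eq. (3.6)] -/
theorem tail_twoSignPositive_of_rules_regular {n : ℕ} (am ap z zb : Fin n → ℝ)
    (hz : ∀ k, z k ∈ Ioo (0 : ℝ) 1) (hzb : ∀ k, zb k ∈ Ioo (0 : ℝ) 1) {s E₀ ET τ : ℝ}
    (hτ1 : τ ≤ 1) (hτ0 : τ ≤ E₀)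
    (hM : ∀ (j : ℕ) (E : ℝ), E₀ ≤ E → E < ET → (j : ℝ) + τ ≤ E → 0 ≤ twoSignTerm am ap z zb s E j)
    (hT : ∀ E : ℝ, ET ≤ E → ∀ j : ℕ, (j : ℝ) ≤ E → 0 ≤ twoSignTerm am ap z zb s E j)
    {Δ : ℝ} {ℓ : ℕ} (hΔ : unitarityBound3D ℓ < Δ) (hreg : ¬ accidentalDegeneracy3D Δ ℓ)
    (hΔ0 : E₀ ≤ Δ) :
    TwoSignPositive am ap z zb s Δ ℓ := by
  refine twoSignPositive_of_forall am ap z zb hz hzb hΔ hreg fun q hq => ?_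
  have hℓτ : (ℓ : ℝ) + τ ≤ Δ := natCast_add_le_of_unitarityBound3D_lt hτ1 hτ0 hΔ hΔ0
  have h1 : (q.2 : ℝ) ≤ (ℓ : ℝ) + (q.1 : ℝ) := by exact_mod_cast hq.2.1
  have hjE : (q.2 : ℝ) + τ ≤ Δ + (q.1 : ℝ) := by linarith
  have hjE' : (q.2 : ℝ) ≤ Δ + (q.1 : ℝ) := by
    linarith [natCast_add_half_le_unitarityBound3D ℓ]
  have hE0 : E₀ ≤ Δ + (q.1 : ℝ) := hΔ0.trans (le_add_of_nonneg_right (Nat.cast_nonneg _))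
  by_cases hlt : Δ + (q.1 : ℝ) < ET
  · exact hM q.2 (Δ + (q.1 : ℝ)) hE0 hlt hjE
  · exact hT (Δ + (q.1 : ℝ)) (not_lt.1 hlt) q.2 hjE'

/-- **The tail of a two-sign row on a box, all points.** In the dominated configuration (apex `a`,
ratios `≤ 1`), rule (M) on `E ∈ [E₀, E_T)`, `j + τ ≤ E` for all `s ∈ [s_lo, s_hi]` (`τ ≤ 1`,
`τ ≤ E₀`) together with `0 ≤ a⁻_a + a⁺_a` and the ONE apex inequality
`R₂(a⁻+a⁺, a⁻-a⁺; s_lo, E_T) ≤ (a⁻_a + a⁺_a) v_a^{s_hi}` give `TwoSignPositive a⁻ a⁺ z z̄ s Δ ℓ` for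
every `s ∈ [s_lo, s_hi]`, every spin `ℓ` and every `Δ ≥ E₀` with `unitarityBound3D ℓ ≤ Δ`
(non-regular points — finitely many per spin above the bound — by right limits,
`twoSignPositive_of_eventually_right`, `eventually_isRegularPoint3D_nhdsGT_of_bound_le`).
[cite: HogervorstRychkov2013, §3 eq. (3.6)] -/
theorem tail_twoSignPositive_of_boxes_and_apex {n : ℕ} (am ap z zb : Fin n → ℝ)
    (hz : ∀ k, z k ∈ Ioo (0 : ℝ) 1) (hzb : ∀ k, zb k ∈ Ioo (0 : ℝ) 1) (hord : ∀ k, zb k ≤ z k)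
    (a : Fin n) (ha : 0 ≤ am a + ap a) (qd qr : Fin n → ℝ) (hqd : ∀ k, 0 < qd k ∧ qd k ≤ 1)
    (hqr : ∀ k, 0 < qr k ∧ qr k ≤ 1)
    (hdomd : ∀ k, z k * zb k ≤ qd k ^ 2 * (z a * zb a) ∧ z k ≤ qd k * z a)
    (hdomr : ∀ k, (1 - z k) * (1 - zb k) ≤ qr k ^ 2 * (z a * zb a) ∧ 1 - zb k ≤ qr k * z a)
    {slo shi E₀ ET τ : ℝ} (hτ1 : τ ≤ 1) (hτ0 : τ ≤ E₀)
    (hM : ∀ (j : ℕ) (E : ℝ), E₀ ≤ E → E < ET → (j : ℝ) + τ ≤ E → ∀ s ∈ Icc slo shi,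
      0 ≤ twoSignTerm am ap z zb s E j)
    (hB : apexRest₂ (am + ap) (am - ap) z zb a qd qr slo ET ≤
      (am a + ap a) * ((1 - z a) * (1 - zb a)) ^ shi) :
    ∀ s ∈ Icc slo shi, ∀ ℓ : ℕ, ∀ Δ : ℝ, unitarityBound3D ℓ ≤ Δ → E₀ ≤ Δ →
      TwoSignPositive am ap z zb s Δ ℓ := by
  intro s hs ℓ Δ hbd hΔ0
  have hT : ∀ E : ℝ, ET ≤ E → ∀ j : ℕ, (j : ℝ) ≤ E → 0 ≤ twoSignTerm am ap z zb s E j := by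
    intro E hE j hj
    rw [twoSignTerm_eq_twoWeightEval]
    exact twoWeightEval_zMono_nonneg_of_apex (am + ap) (am - ap) z zb hz hzb hord a ha qd qr hqd hqr
      hdomd hdomr hB E hE j hj s hs
  have hMs : ∀ (j : ℕ) (E : ℝ), E₀ ≤ E → E < ET → (j : ℝ) + τ ≤ E →
      0 ≤ twoSignTerm am ap z zb s E j := fun j E h1 h2 h3 => hM j E h1 h2 h3 s hs
  by_cases hregpt : IsRegularPoint3D Δ ℓ
  · exact tail_twoSignPositive_of_rules_regular am ap z zb hz hzb hτ1 hτ0 hMs hT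
      (lt_of_le_of_ne hbd (Ne.symm hregpt.1)) hregpt.2 hΔ0
  · refine twoSignPositive_of_eventually_right am ap z zb hz hzb s Δ ℓ hregpt ?_
    filter_upwards [eventually_isRegularPoint3D_nhdsGT_of_bound_le hbd, self_mem_nhdsWithin]
      with Δ' hΔ' hgt
    have hgt' : Δ < Δ' := Set.mem_Ioi.1 hgt
    exact ⟨hΔ', tail_twoSignPositive_of_rules_regular am ap z zb hz hzb hτ1 hτ0 hMs hT
      (lt_of_le_of_lt hbd hgt') hΔ'.2 (hΔ0.trans hgt'.le)⟩

/-- **The tail of a two-sign row from a finite table and one apex inequality.** As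
`tail_twoSignPositive_of_boxes_and_apex` with rule (M) discharged by `ruleM_twoSign_of_boxTable`: the
certificate's numbers are, per `j` with `j + τ < E_T`, the box endpoints `e_{j,·}` and one corner
number `cornerBound₂ ≥ 0` per box, and the apex data. This is the shape of the tail obligations
`(O7)–(O9)` of an `O(N)` vector points certificate (one instance per sector).
[cite: HogervorstRychkov2013, §3 eq. (3.6)] -/
theorem tail_twoSignPositive_of_table_and_apex {n : ℕ} (am ap z zb : Fin n → ℝ)
    (hz : ∀ k, z k ∈ Ioo (0 : ℝ) 1) (hzb : ∀ k, zb k ∈ Ioo (0 : ℝ) 1) (hord : ∀ k, zb k ≤ z k)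
    (a : Fin n) (ha : 0 ≤ am a + ap a) (qd qr : Fin n → ℝ) (hqd : ∀ k, 0 < qd k ∧ qd k ≤ 1)
    (hqr : ∀ k, 0 < qr k ∧ qr k ≤ 1)
    (hdomd : ∀ k, z k * zb k ≤ qd k ^ 2 * (z a * zb a) ∧ z k ≤ qd k * z a)
    (hdomr : ∀ k, (1 - z k) * (1 - zb k) ≤ qr k ^ 2 * (z a * zb a) ∧ 1 - zb k ≤ qr k * z a)
    {slo shi E₀ ET τ : ℝ} (hτ1 : τ ≤ 1) (hτ0 : τ ≤ E₀)
    (e : ℕ → ℕ → ℝ) (M : ℕ → ℕ)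
    (he : ∀ j : ℕ, (j : ℝ) + τ < ET → e j 0 ≤ max E₀ ((j : ℝ) + τ) ∧ ET ≤ e j (M j))
    (hbox : ∀ j : ℕ, (j : ℝ) + τ < ET → ∀ m < M j,
      0 ≤ cornerBound₂ (am + ap) (am - ap) z zb j (e j m) (e j (m + 1)) slo shi)
    (hB : apexRest₂ (am + ap) (am - ap) z zb a qd qr slo ET ≤
      (am a + ap a) * ((1 - z a) * (1 - zb a)) ^ shi) :
    ∀ s ∈ Icc slo shi, ∀ ℓ : ℕ, ∀ Δ : ℝ, unitarityBound3D ℓ ≤ Δ → E₀ ≤ Δ →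
      TwoSignPositive am ap z zb s Δ ℓ :=
  tail_twoSignPositive_of_boxes_and_apex am ap z zb hz hzb hord a ha qd qr hqd hqr hdomd hdomr hτ1 hτ0
    (ruleM_twoSign_of_boxTable am ap z zb hz hzb τ e M he hbox) hB

end Literature.MathematicalPhysics.QuantumFieldTheory.ConformalBootstrap3D
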